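import Mathlib
import Literature.NumberTheory.Transcendental.KZSemiCanonicalReductionProofs
import Summits.KontsevichZagierPeriods.KontsevichZagierPeriods.Theorems.InverseLandauTateLiftingDimOneCells
import Summits.KontsevichZagierPeriods.KontsevichZagierPeriods.Theorems.InverseLandauTateLiftingDimOneUnitChart
import Summits.KontsevichZagierPeriods.KontsevichZagierPeriods.Theorems.InverseLandauTateLiftingDimOneUnitKernel
import Summits.KontsevichZagierPeriods.KontsevichZagierPeriods.Theorems.InverseLandauTateLiftingDimZeroLift

/-!
# `TateLifting` (stmt-KontsevichZagierPeriods-9129), line `Sketch` — the dimension-one rational sector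

Crux `Summit.KontsevichZagierPeriods.KontsevichZagierPeriods.Theses.InverseLandau.TateLifting`
(`ker KZ.eval ⊆ KZ.relations ⊔ closure T`, `T` = Tate fibres) is Conjecture-1-strength in general. This
file lands its COMPLETE DIMENSION-ONE KZ-RATIONAL SECTOR and, as a corollary, KZ's Conjecture 1 for
representations of dimension `≤ 1`:

* `tateLifting_dimOneRationalSector` — every vanishing `ℤ`-combination `Σ mᵢ [rᵢ]` of KZ-rational
  representations of dimension `1` (integrand `p/q`, `p q ∈ ℚ[x]`, over ANY `ℚ`-semialgebraic subset of
  `ℝ`, absolutely convergent) lies in `KZ.relations`;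
* `TateLifting_dimOneRationalSector` — hence in `KZ.relations ⊔ closure T` (the crux on this sector);
* `kzPeriodConjecture_dim_le_one` — two KZ-rational representations of dimensions `n, m ≤ 1` with the
  same value are KZ-equivalent (this is `Literature.Periods.KZPeriodConjecture` restricted to `n, m ≤ 1`,
  verbatim the statement of the crux `LowdimBaker0DimLeOne` of route LowDimension,
  stmt-KontsevichZagierPeriods-10622).

Spine (composition of four landed stubs of the line): Viu-Sos compactification
`KZ.exists_sub_sum_bounded_mem_relations` ⟶ 1-cells with algebraic break points
(`tateLifting_dimOneCells`) ⟶ unit chart of every cell (`tateLifting_dimOneUnitChart`) ⟶ flattening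
in the free abelian group and transport of the vanishing evaluation along the relations used (soundness
`KZ.relations_le_ker_eval_holds`) ⟶ unit-form kernel (`tateLifting_dimOneUnitKernel`: merge + the
dimension-one transfer `algCoeffKernelDimOne` over Hermite reduction, real partial fractions, Baker's
theorem `baker_holds`, the logarithmic Newton–Leibniz rule, arcs of `du/(1+u²)` and arc scissors) ⟶
dimension-zero lift (`tateLifting_dimZeroLift`) for the two-representation corollary.
-/

noncomputable section

namespace Summit.KontsevichZagierPeriods.InverseLandau

open MeasureTheory Set
open Literature.NumberTheory.Transcendental

namespace DimOne

/-- KZ-rationality passes to a representation on a subdomain with the same integrand. [folklore] -/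
theorem isRational_of_subset {r ρ : KZ.IntegralRep 1} (hr : r.IsRational) (hd : ρ.domain ⊆ r.domain)
    (hi : ρ.integrand = r.integrand) : ρ.IsRational := by
  obtain ⟨p, q, hq, hpq⟩ := hr
  exact ⟨p, q, fun x hx => hq x (hd hx), fun x hx => by rw [hi]; exact hpq (hd hx)⟩

/-- KZ-rational representations of dimension `≤ 1` lift to KZ-rational representations of dimension
`1` modulo relations (`tateLifting_dimZeroLift` in dimension `0`, nothing to do in dimension `1`).
[cite: KontsevichZagier2001, §1.2] -/
theorem exists_isRational_one_of_le_one :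
    ∀ ⦃n : ℕ⦄, n ≤ 1 → ∀ r : KZ.IntegralRep n, r.IsRational →
      ∃ ρ : KZ.IntegralRep 1, ρ.IsRational ∧ KZ.of r - KZ.of ρ ∈ KZ.relations := by
  intro n hn r hr
  rcases Nat.le_one_iff_eq_zero_or_eq_one.mp hn with rfl | rfl
  · exact tateLifting_dimZeroLift r hr
  · exact ⟨r, hr, by rw [sub_self]; exact KZ.relations.zero_mem⟩

end DimOne

/-- **The dimension-one rational sector, kernel form.** Every vanishing `ℤ`-combination of
KZ-rational integral representations of dimension `1` is a relation of the Kontsevich–Zagier calculus: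
compactify every representation (Viu-Sos, `KZ.exists_sub_sum_bounded_mem_relations`), cut the bounded
pieces into 1-cells (`tateLifting_dimOneCells`), put every cell in unit form
(`tateLifting_dimOneUnitChart`), flatten the bookkeeping in the free abelian group, transport the
vanishing of the evaluation along the relations used (soundness `KZ.relations_le_ker_eval_holds`), and
apply the unit-form kernel (`tateLifting_dimOneUnitKernel`, which rests on Baker's theorem).
[cite: Baker1975, Thm 2.1] -/
theorem tateLifting_dimOneRationalSector :
    ∀ (s : ℕ) (m : Fin s → ℤ) (r : Fin s → KZ.IntegralRep 1), (∀ i, (r i).IsRational) →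
      KZ.eval (∑ i, m i • KZ.of (r i)) = 0 → ∑ i, m i • KZ.of (r i) ∈ KZ.relations := by
  intro s m r hrat hev
  classical
  -- Step 1: compactify (Viu-Sos): `[r i] ≡ Σ_T [R i T]`, `R i T` rational on a bounded domain
  choose R hR hRrel using fun i => KZ.exists_sub_sum_bounded_mem_relations (r i) (hrat i)
  -- Step 2: 1-cells of every bounded piece
  choose k u v ρ halg hρd hρsub hρi hρrel using fun i T => tateLifting_dimOneCells (R i T) (hR i T).2
  -- Step 3: unit chart of every cell
  have hρrat : ∀ i T j, (ρ i T j).IsRational := fun i T j =>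
    DimOne.isRational_of_subset (hR i T).1 (hρsub i T j) (hρi i T j)
  choose p q ρ' hp hq hq0 hρ'd hρ'i hρ'rel using fun i T j =>
    tateLifting_dimOneUnitChart (u i T j) (v i T j) (halg i T j).1 (halg i T j).2.1 (halg i T j).2.2
      (ρ i T j) (hρd i T j) (hρrat i T j)
  -- Step 4: flatten the index set `Σ i, Σ T, Fin (k i T)` to `Fin K`
  obtain ⟨K, ⟨e⟩⟩ := Finite.exists_equiv_fin (Σ i : Fin s, Σ T : Finset (Fin 1), Fin (k i T))
  -- Step 5: the flattened combination is the nested one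
  have hsum : ∑ l : Fin K, m (e.symm l).1 • KZ.of (ρ' (e.symm l).1 (e.symm l).2.1 (e.symm l).2.2) =
      ∑ i, m i • ∑ T, ∑ j, KZ.of (ρ' i T j) := by
    have e1 : ∑ l : Fin K, m (e.symm l).1 • KZ.of (ρ' (e.symm l).1 (e.symm l).2.1 (e.symm l).2.2) =
        ∑ x : (Σ i : Fin s, Σ T : Finset (Fin 1), Fin (k i T)), m x.1 • KZ.of (ρ' x.1 x.2.1 x.2.2) :=
      Fintype.sum_equiv e.symm _ _ fun l => rfl
    rw [e1]
    simp only [Fintype.sum_sigma, Finset.smul_sum]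
  -- Step 6: the difference with the original combination is a relation
  have hdiff : ∑ i, m i • KZ.of (r i) - ∑ i, m i • ∑ T, ∑ j, KZ.of (ρ' i T j) ∈ KZ.relations := by
    rw [← Finset.sum_sub_distrib]
    refine sum_mem fun i _ => ?_
    rw [← smul_sub]
    refine KZ.relations.zsmul_mem ?_ _
    have h1 : ∀ T, KZ.of (R i T) - ∑ j, KZ.of (ρ' i T j) ∈ KZ.relations := fun T => by
      have h2 : ∑ j, KZ.of (ρ i T j) - ∑ j, KZ.of (ρ' i T j) ∈ KZ.relations := by
        rw [← Finset.sum_sub_distrib]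
        exact sum_mem fun j _ => hρ'rel i T j
      have h3 := KZ.relations.add_mem (hρrel i T) h2
      rwa [sub_add_sub_cancel] at h3
    have h4 : ∑ T, KZ.of (R i T) - ∑ T, ∑ j, KZ.of (ρ' i T j) ∈ KZ.relations := by
      rw [← Finset.sum_sub_distrib]
      exact sum_mem fun T _ => h1 T
    have h5 := KZ.relations.add_mem (hRrel i) h4
    rwa [sub_add_sub_cancel] at h5
  -- Step 7: the flattened combination has vanishing evaluation (soundness of the moves)
  have hev' : KZ.eval (∑ l : Fin K, m (e.symm l).1 •
      KZ.of (ρ' (e.symm l).1 (e.symm l).2.1 (e.symm l).2.2)) = 0 := by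
    have h0 := KZ.relations_le_ker_eval_holds hdiff
    rw [AddMonoidHom.mem_ker, map_sub, hev, zero_sub, neg_eq_zero] at h0
    rw [hsum, h0]
  -- Step 8: the unit-form kernel, and reassembly
  have hker := tateLifting_dimOneUnitKernel K (fun l => m (e.symm l).1)
    (fun l => p (e.symm l).1 (e.symm l).2.1 (e.symm l).2.2)
    (fun l => q (e.symm l).1 (e.symm l).2.1 (e.symm l).2.2)
    (fun l => ρ' (e.symm l).1 (e.symm l).2.1 (e.symm l).2.2)
    (fun l n => hp _ _ _ n) (fun l n => hq _ _ _ n) (fun l => hq0 _ _ _) (fun l => hρ'd _ _ _)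
    (fun l => hρ'i _ _ _) hev'
  rw [hsum] at hker
  have h := KZ.relations.add_mem hdiff hker
  rwa [sub_add_cancel] at h

/-- **The dimension-one rational sector of the crux `TateLifting`.** Every vanishing `ℤ`-combination
of KZ-rational integral representations of dimension `1` lies in `KZ.relations ⊔ closure T`, `T` the
crux's set of Tate fibres (verbatim) — indeed in `KZ.relations` (`tateLifting_dimOneRationalSector`).
[cite: Baker1975, Thm 2.1] -/
theorem TateLifting_dimOneRationalSector :
    ∀ (s : ℕ) (m : Fin s → ℤ) (r : Fin s → KZ.IntegralRep 1), (∀ i, (r i).IsRational) →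
      KZ.eval (∑ i, m i • KZ.of (r i)) = 0 →
      ∑ i, m i • KZ.of (r i) ∈ KZ.relations ⊔ AddSubgroup.closure
        {d : KZ.FormalRep | ∃ (n : ℕ) (P Q : MvPolynomial (Fin (n + 1)) ℚ) (ε ϖ₀ : ℝ)
            (r : KZ.IntegralRep n), 0 < ε ∧
          (∃ c₀ : ℚ, c₀ ≠ 0 ∧ ∀ z : Fin n → ℝ,
            MvPolynomial.aeval (Fin.snoc z (0 : ℝ) : Fin (n + 1) → ℝ) Q = (c₀ : ℝ)) ∧
          (∀ (z : Fin n → ℝ) (ϖ : ℝ), (∀ i, z i ∈ Set.Icc (0 : ℝ) 1) → ϖ ∈ Set.Ioo 0 ε →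
            MvPolynomial.aeval (Fin.snoc z ϖ : Fin (n + 1) → ℝ) Q ≠ 0) ∧
          (∀ ϖ ∈ Set.Ioo (0 : ℝ) ε, ∫ z in Set.pi Set.univ (fun _ : Fin n => Set.Ioo (0 : ℝ) 1),
            MvPolynomial.aeval (Fin.snoc z ϖ : Fin (n + 1) → ℝ) P /
              MvPolynomial.aeval (Fin.snoc z ϖ : Fin (n + 1) → ℝ) Q = 0) ∧
          IsAlgebraic ℚ ϖ₀ ∧ ϖ₀ ∈ Set.Ioo 0 ε ∧
          r.domain = Set.pi Set.univ (fun _ : Fin n => Set.Ioo (0 : ℝ) 1) ∧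
          Set.EqOn r.integrand (fun z => MvPolynomial.aeval (Fin.snoc z ϖ₀ : Fin (n + 1) → ℝ) P /
            MvPolynomial.aeval (Fin.snoc z ϖ₀ : Fin (n + 1) → ℝ) Q) r.domain ∧
          d = KZ.of r} :=
  fun s m r hrat hev => AddSubgroup.mem_sup_left (tateLifting_dimOneRationalSector s m r hrat hev)

/-- **KZ's Conjecture 1 in dimension `≤ 1`.** Two KZ-rational integral representations of
dimensions `n, m ≤ 1` (integrand `p/q`, `p q ∈ ℚ[x₁..xₙ]`, absolutely integrable over a
`ℚ`-semialgebraic subset of `ℝⁿ`, `n ≤ 1`) with the same value are KZ-equivalent: lift both to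
dimension `1` (`DimOne.exists_isRational_one_of_le_one`), where `[ρ] − [ρ']` is a vanishing
`ℤ`-combination of KZ-rational representations, hence a relation by the dimension-one rational sector.
This is `Literature.Periods.KZPeriodConjecture` restricted to `n, m ≤ 1`, i.e. the statement of the crux
`LowdimBaker0DimLeOne` of route LowDimension (stmt-KontsevichZagierPeriods-10622).
[cite: Baker1975, Thm 2.1] -/
theorem kzPeriodConjecture_dim_le_one :
    ∀ ⦃n m : ℕ⦄, n ≤ 1 → m ≤ 1 → ∀ (r : KZ.IntegralRep n) (r' : KZ.IntegralRep m),
      r.IsRational → r'.IsRational → r.value = r'.value → KZ.Equivalent r r' := by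
  intro n m hn hm r r' hr hr' hv
  obtain ⟨ρ, hρ, h1⟩ := DimOne.exists_isRational_one_of_le_one hn r hr
  obtain ⟨ρ', hρ', h2⟩ := DimOne.exists_isRational_one_of_le_one hm r' hr'
  have hvρ : ρ.value = r.value := (KZ.Equivalent.value_eq_holds h1).symm
  have hvρ' : ρ'.value = r'.value := (KZ.Equivalent.value_eq_holds h2).symm
  have e : ∑ i : Fin 2, (![1, -1] : Fin 2 → ℤ) i • KZ.of ((![ρ, ρ'] : Fin 2 → KZ.IntegralRep 1) i) =
      KZ.of ρ - KZ.of ρ' := by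
    rw [Fin.sum_univ_two]
    simp only [Matrix.cons_val_zero, Matrix.cons_val_one, one_smul, neg_smul, sub_eq_add_neg]
  have hev : KZ.eval (∑ i : Fin 2, (![1, -1] : Fin 2 → ℤ) i •
      KZ.of ((![ρ, ρ'] : Fin 2 → KZ.IntegralRep 1) i)) = 0 := by
    rw [e, map_sub, KZ.eval_of, KZ.eval_of, hvρ, hvρ', hv, sub_self]
  have hmem := tateLifting_dimOneRationalSector 2 ![1, -1] ![ρ, ρ']
    (fun i => by fin_cases i; exacts [hρ, hρ']) hev
  rw [e] at hmem
  show KZ.of r - KZ.of r' ∈ KZ.relations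
  have e2 : KZ.of r - KZ.of r' =
      (KZ.of r - KZ.of ρ) + (KZ.of ρ - KZ.of ρ') - (KZ.of r' - KZ.of ρ') := by abel
  rw [e2]
  exact KZ.relations.sub_mem (KZ.relations.add_mem h1 hmem) h2

/-- **The kernel form of Conjecture 1 on the subgroup generated by KZ-rational representations of
dimension `≤ 1`.** Every formal `ℤ`-combination of KZ-rational representations of dimensions `0` and `1`
with vanishing evaluation is a relation: write it as a finite `ℤ`-combination of generators
(`Submodule.mem_span_set'` for the `ℤ`-span), lift every generator to dimension `1`
(`DimOne.exists_isRational_one_of_le_one`), and apply the dimension-one rational sector.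
[cite: Baker1975, Thm 2.1] -/
theorem kzKernelConjecture_dim_le_one :
    ∀ c ∈ AddSubgroup.closure
        {d : KZ.FormalRep | ∃ (n : ℕ) (r : KZ.IntegralRep n), n ≤ 1 ∧ r.IsRational ∧ d = KZ.of r},
      KZ.eval c = 0 → c ∈ KZ.relations := by
  intro c hc hev
  classical
  rw [← Submodule.span_int_eq_addSubgroupClosure, Submodule.mem_toAddSubgroup,
    Submodule.mem_span_set'] at hc
  obtain ⟨k, f, g, rfl⟩ := hc
  choose n r hn hr hg using fun i => (g i).2
  choose ρ hρ hρrel using fun i => DimOne.exists_isRational_one_of_le_one (hn i) (r i) (hr i)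
  -- the lifted combination differs from `c` by a relation
  have hdiff : ∑ i, f i • ((g i : KZ.FormalRep)) - ∑ i, f i • KZ.of (ρ i) ∈ KZ.relations := by
    rw [← Finset.sum_sub_distrib]
    refine sum_mem fun i _ => ?_
    rw [← smul_sub, hg i]
    exact KZ.relations.zsmul_mem (hρrel i) _
  have hev' : KZ.eval (∑ i, f i • KZ.of (ρ i)) = 0 := by
    have h0 := KZ.relations_le_ker_eval_holds hdiff
    rw [AddMonoidHom.mem_ker, map_sub, hev, zero_sub, neg_eq_zero] at h0
    exact h0
  have hker := tateLifting_dimOneRationalSector k f ρ hρ hev'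
  have h := KZ.relations.add_mem hdiff hker
  rwa [sub_add_cancel] at h

end Summit.KontsevichZagierPeriods.InverseLandau

end
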